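import Mathlib.Analysis.SumIntegralComparisons
import Mathlib.Analysis.SpecialFunctions.Integrals.Basic
import Mathlib.Analysis.SpecialFunctions.Trigonometric.Series
import Mathlib.Analysis.SpecialFunctions.Trigonometric.DerivHyp
import Mathlib.NumberTheory.Harmonic.Bounds
import HarnessLib

/-!
# Lattice sums behind the Euclidean logarithmic test potential: `Σ_{0<|u|_∞<ρ} |u|⁻² ≤ 2π H(ρ) + 8`

Trunk T-QLATTICE (family `hubbard`; consumer: the Euclidean logarithmic dipole
`TorusEuclidLogDipole.lean` and the sharp Koma–Tasaki `η`-line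
`Summits/HubbardSuperconductivity/HubbardLadder/Bounds/PairCorrelationEtaLineEuclid.lean`).

Koma–Tasaki (PRL 68 (1992) 3248, proof of eq. (13)), following McBryan–Spencer (CMP 53 (1977)
299), bound the energy `Σ_{bonds} (cosh ∇φ - 1)` of a logarithmic test potential
`φ(u) ≈ q log|u|` by `≈ (q²/2) Σ_{bonds} |∇φ|² ≈ (q²/2) Σ_{0<|u|<R} |u|⁻² ≈ π q² log R`
(property P2). This file proves the two elementary real-variable inputs of the EXPLICIT Euclidean
version `φ(u) = (q/2) log(a² + b²)` (`a, b` the cyclic coordinates) used in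
`TorusEuclidLogDipole.lean`:

* `sum_sum_inv_normSq_le` — the row-by-row arctangent bound
  `Σ_{(a,b) ∈ [0,ρ)², (a,b) ≠ 0} μ_a μ_b /(a² + b²) ≤ 2π H(ρ) + 8` (`μ_0 = 1`, `μ_k = 2` for
  `k ≥ 1` are the `ℤ²`-multiplicities of the quadrant; `H` = harmonic numbers), from
  `Σ_{j=1}^{B} 1/(a² + j²) ≤ ∫_0^B dx/(a² + x²) ≤ π/(2a)`;
* `sum_sum_secondary_le` — `Σ μ_a μ_b (a + b + 1)/(a² + b²)² ≤ 68` (the lattice corrections);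
* `two_dir_cosh_sub_one_le` — the per-site majorant
  `Σ_{i} μ'_{a_i} (cosh(q(2a_i+1)/(2n)) - 1) ≤ q²/(2n) + (q²/2 + 4q⁴e^{2q²})(a+b+1)/n²`,
  `n = a² + b² ≥ 1`, from `cosh x - 1 ≤ x²/2 + (x⁴/4) e^{x²/2}` (an ADDITIVE quartic remainder, so
  that the coefficient of the logarithm is exactly `(q²/2)·2π·2 = 2π q²` per monopole).

Sources: T. Koma, H. Tasaki, PRL 68 (1992) 3248, proof of eq. (13) (P2); O. A. McBryan,
T. Spencer, Commun. Math. Phys. 53 (1977) 299.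

## Mathlib search

`AntitoneOn.sum_le_integral`, `integral_inv_one_add_sq`, `intervalIntegral.integral_comp_div`,
`Real.arctan_lt_pi_div_two`, `Real.cosh_le_exp_half_sq`, `Real.add_one_le_exp`, `harmonic`,
`harmonic_succ`, `Finset.sum_range_succ'`, `Finset.sum_range_sub'`, `Real.pi_le_four`.
-/

noncomputable section

namespace Literature.MathematicalPhysics.QuantumLattice

open Finset

/-! ### One-dimensional inputs -/

/-- `∫_0^B dx/(a² + x²) ≤ π/(2a)` for `a > 0`. [folklore] -/
private theorem integral_inv_sq_add_sq_le {a : ℝ} (ha : 0 < a) (B : ℝ) :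
    ∫ x in (0:ℝ)..B, (a ^ 2 + x ^ 2)⁻¹ ≤ Real.pi / (2 * a) := by
  have h1 : (fun x : ℝ => (a ^ 2 + x ^ 2)⁻¹) = fun x => (a ^ 2)⁻¹ * (1 + (x / a) ^ 2)⁻¹ := by
    funext x
    rw [← mul_inv]
    congr 1
    rw [div_pow, mul_add, mul_one, mul_div_cancel₀ _ (pow_ne_zero 2 ha.ne')]
  rw [h1, intervalIntegral.integral_const_mul,
    intervalIntegral.integral_comp_div (fun x : ℝ => (1 + x ^ 2)⁻¹) ha.ne', zero_div,
    integral_inv_one_add_sq, Real.arctan_zero, sub_zero, smul_eq_mul]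
  have harc : Real.arctan (B / a) ≤ Real.pi / 2 := (Real.arctan_lt_pi_div_two _).le
  calc (a ^ 2)⁻¹ * (a * Real.arctan (B / a)) ≤ (a ^ 2)⁻¹ * (a * (Real.pi / 2)) := by
        gcongr
    _ = Real.pi / (2 * a) := by
        field_simp

/-- `Σ_{j=1}^{B} 1/(a² + j²) ≤ π/(2a)` for integers `a ≥ 1` (the summand decreases in `j`, so the
sum is at most `∫_0^B dx/(a² + x²)`). [folklore] -/
private theorem sum_inv_sq_add_sq_le (a B : ℕ) (ha : 1 ≤ a) :
    ∑ j ∈ range B, (((a : ℝ) ^ 2 + ((j : ℝ) + 1) ^ 2)⁻¹) ≤ Real.pi / (2 * a) := by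
  have ha0 : (0 : ℝ) < a := by exact_mod_cast ha
  have hanti : AntitoneOn (fun x : ℝ => ((a : ℝ) ^ 2 + x ^ 2)⁻¹)
      (Set.Icc (0:ℝ) ((0:ℝ) + (B : ℕ))) := by
    intro x hx y _ hxy
    have hx0 : 0 ≤ x := hx.1
    have hxy2 : x ^ 2 ≤ y ^ 2 := by nlinarith [mul_nonneg hx0 (sub_nonneg.2 hxy)]
    exact inv_anti₀ (by positivity) (by linarith)
  have key := hanti.sum_le_integral
  simp only [zero_add, Nat.cast_add, Nat.cast_one] at key
  exact key.trans (integral_inv_sq_add_sq_le ha0 B)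

/-- `Σ_{j=1}^{B} 1/j² ≤ 2` (telescoping against `1/(j(j+1))`). [folklore] -/
private theorem sum_inv_succ_sq_le_two (B : ℕ) :
    ∑ j ∈ range B, ((((j : ℝ) + 1) ^ 2)⁻¹) ≤ 2 := by
  set g : ℕ → ℝ := fun j => if j = 0 then 2 else ((j : ℝ))⁻¹ with hg
  have hterm : ∀ j : ℕ, ((((j : ℝ) + 1) ^ 2)⁻¹) ≤ g j - g (j + 1) := by
    intro j
    rcases Nat.eq_zero_or_pos j with rfl | hj
    · simp [hg]
      norm_num
    · have hj0 : (0 : ℝ) < j := by exact_mod_cast hj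
      have hne : j ≠ 0 := by omega
      simp only [hg, if_neg hne, if_neg (Nat.succ_ne_zero j), Nat.cast_succ]
      rw [show ((j : ℝ))⁻¹ - ((j : ℝ) + 1)⁻¹ = ((j : ℝ) * ((j : ℝ) + 1))⁻¹ by
        field_simp; ring]
      exact inv_anti₀ (by positivity) (by nlinarith)
  have hgB : 0 ≤ g B := by
    simp only [hg]
    split_ifs
    · norm_num
    · positivity
  calc ∑ j ∈ range B, ((((j : ℝ) + 1) ^ 2)⁻¹) ≤ ∑ j ∈ range B, (g j - g (j + 1)) :=
        sum_le_sum fun j _ => hterm j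
    _ = g 0 - g B := sum_range_sub' g B
    _ ≤ 2 := by simp only [hg, if_pos rfl]; linarith

/-- `Σ_{j<B} 1/(j+1) = H(B)` over `ℝ`. [folklore] -/
private theorem sum_range_inv_succ_eq_harmonic (B : ℕ) :
    ∑ j ∈ range B, (((j : ℝ) + 1)⁻¹) = (harmonic B : ℝ) := by
  induction B with
  | zero => simp
  | succ n ih =>
      rw [sum_range_succ, ih, harmonic_succ]
      push_cast
      ring

/-! ### The row sums with `ℤ²`-multiplicities -/

/-- Row `a ≥ 1` of the quadrant: `Σ_{b<ρ} μ_b/(a² + b²) ≤ 1/a² + π/a` (`μ_0 = 1`, `μ_b = 2`).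
[folklore] -/
private theorem row_sum_inv_normSq_le (a ρ : ℕ) (ha : 1 ≤ a) :
    ∑ b ∈ range ρ, (if b = 0 then (1:ℝ) else 2) * (((a : ℝ) ^ 2 + (b : ℝ) ^ 2)⁻¹) ≤
      ((a : ℝ) ^ 2)⁻¹ + Real.pi / a := by
  have ha0 : (0 : ℝ) < a := by exact_mod_cast ha
  rcases Nat.eq_zero_or_pos ρ with rfl | hρ
  · simp only [range_zero, sum_empty]
    positivity
  · obtain ⟨B, rfl⟩ : ∃ B, ρ = B + 1 := ⟨ρ - 1, by omega⟩
    rw [sum_range_succ']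
    have h0 : (if (0:ℕ) = 0 then (1:ℝ) else 2) * (((a : ℝ) ^ 2 + ((0:ℕ) : ℝ) ^ 2)⁻¹) =
        ((a : ℝ) ^ 2)⁻¹ := by simp
    have h2 : ∑ j ∈ range B, (if j + 1 = 0 then (1:ℝ) else 2) *
        (((a : ℝ) ^ 2 + ((j + 1 : ℕ) : ℝ) ^ 2)⁻¹) =
        2 * ∑ j ∈ range B, (((a : ℝ) ^ 2 + ((j : ℝ) + 1) ^ 2)⁻¹) := by
      rw [mul_sum]
      refine sum_congr rfl fun j _ => ?_
      rw [if_neg (Nat.succ_ne_zero j)]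
      push_cast
      ring
    rw [h0, h2]
    have hs := sum_inv_sq_add_sq_le a B ha
    calc 2 * ∑ j ∈ range B, (((a : ℝ) ^ 2 + ((j : ℝ) + 1) ^ 2)⁻¹) + ((a : ℝ) ^ 2)⁻¹
        ≤ 2 * (Real.pi / (2 * a)) + ((a : ℝ) ^ 2)⁻¹ := by gcongr
      _ = ((a : ℝ) ^ 2)⁻¹ + Real.pi / a := by field_simp; ring

/-- Row `a ≥ 1`, lattice corrections: `Σ_{b<ρ} μ_b (a+b+1)/(a²+b²)² ≤ 3(1/a² + π/a)/a`, from
`(a+b+1)/(a²+b²)² ≤ 3/(a(a²+b²))`. [folklore] -/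
private theorem row_sum_secondary_le (a ρ : ℕ) (ha : 1 ≤ a) :
    ∑ b ∈ range ρ, (if b = 0 then (1:ℝ) else 2) *
        (((a : ℝ) + b + 1) * ((((a : ℝ) ^ 2 + (b : ℝ) ^ 2) ^ 2)⁻¹)) ≤
      3 * (((a : ℝ) ^ 2)⁻¹ + Real.pi / a) / a := by
  have ha0 : (0 : ℝ) < a := by exact_mod_cast ha
  have ha1 : (1 : ℝ) ≤ a := by exact_mod_cast ha
  have hpt : ∀ b : ℕ, ((a : ℝ) + b + 1) * ((((a : ℝ) ^ 2 + (b : ℝ) ^ 2) ^ 2)⁻¹) ≤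
      3 / a * (((a : ℝ) ^ 2 + (b : ℝ) ^ 2)⁻¹) := by
    intro b
    have hb0 : (0 : ℝ) ≤ b := Nat.cast_nonneg b
    have hn : (0 : ℝ) < (a : ℝ) ^ 2 + (b : ℝ) ^ 2 := by positivity
    rw [← div_eq_mul_inv, ← div_eq_mul_inv, div_div,
      div_le_div_iff₀ (by positivity) (by positivity)]
    nlinarith [sq_nonneg ((a : ℝ) - b), sq_nonneg (b : ℝ), mul_nonneg hb0 hn.le,
      mul_nonneg (sub_nonneg.2 ha1) hn.le]
  calc ∑ b ∈ range ρ, (if b = 0 then (1:ℝ) else 2) *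
          (((a : ℝ) + b + 1) * ((((a : ℝ) ^ 2 + (b : ℝ) ^ 2) ^ 2)⁻¹))
      ≤ ∑ b ∈ range ρ, (if b = 0 then (1:ℝ) else 2) *
          (3 / a * (((a : ℝ) ^ 2 + (b : ℝ) ^ 2)⁻¹)) := by
        refine sum_le_sum fun b _ => mul_le_mul_of_nonneg_left (hpt b) ?_
        split_ifs <;> norm_num
    _ = 3 / a * ∑ b ∈ range ρ, (if b = 0 then (1:ℝ) else 2) *
          (((a : ℝ) ^ 2 + (b : ℝ) ^ 2)⁻¹) := by
        rw [mul_sum]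
        refine sum_congr rfl fun b _ => ?_
        ring
    _ ≤ 3 / a * (((a : ℝ) ^ 2)⁻¹ + Real.pi / a) :=
        mul_le_mul_of_nonneg_left (row_sum_inv_normSq_le a ρ ha) (by positivity)
    _ = 3 * (((a : ℝ) ^ 2)⁻¹ + Real.pi / a) / a := by ring

/-! ### The two-dimensional sums -/

/-- **The `2π log` of the Euclidean logarithmic potential** (lattice form of Koma–Tasaki's P2):
with the `ℤ²`-multiplicities `μ_0 = 1`, `μ_k = 2`,
`Σ_{(a,b) ∈ [0,ρ)², (a,b) ≠ (0,0)} μ_a μ_b /(a² + b²) ≤ 2π H(ρ) + 8`, i.e.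
`Σ_{u ∈ ℤ², 0 < |u|_∞ < ρ} |u|₂⁻² ≤ 2π H(ρ) + 8`. Koma–Tasaki, PRL 68 (1992) 3248, proof of
eq. (13), property P2 (`Σ|∇φ|² ≈ (q²/π) log|x-y|`), after McBryan–Spencer (1977).
[cite: KomaTasakiPRL1992, proof of eq. (13) (P2)] -/
theorem sum_sum_inv_normSq_le (ρ : ℕ) :
    ∑ a ∈ range ρ, ∑ b ∈ range ρ,
      (if a = 0 ∧ b = 0 then (0:ℝ) else
        (if a = 0 then (1:ℝ) else 2) * (if b = 0 then (1:ℝ) else 2) *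
          (((a : ℝ) ^ 2 + (b : ℝ) ^ 2)⁻¹)) ≤ 2 * Real.pi * (harmonic ρ : ℝ) + 8 := by
  set F : ℕ → ℕ → ℝ := fun a b =>
    if a = 0 ∧ b = 0 then (0:ℝ) else
      (if a = 0 then (1:ℝ) else 2) * (if b = 0 then (1:ℝ) else 2) *
        (((a : ℝ) ^ 2 + (b : ℝ) ^ 2)⁻¹) with hF
  rcases Nat.eq_zero_or_pos ρ with rfl | hρ
  · simp
  · obtain ⟨B, rfl⟩ : ∃ B, ρ = B + 1 := ⟨ρ - 1, by omega⟩
    rw [sum_range_succ']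
    -- the row `a = 0`
    have hrow0 : ∑ b ∈ range (B + 1), F 0 b ≤ 4 := by
      rw [sum_range_succ']
      have ht : ∀ j : ℕ, F 0 (j + 1) = 2 * ((((j : ℝ) + 1) ^ 2)⁻¹) := by
        intro j
        simp only [hF, Nat.succ_ne_zero, and_false, if_false, if_true]
        push_cast
        ring
      have hz : F 0 0 = 0 := by simp [hF]
      rw [sum_congr rfl fun j _ => ht j, hz, add_zero, ← mul_sum]
      linarith [sum_inv_succ_sq_le_two B]
    -- the rows `a = j + 1`
    have hrows : ∀ j : ℕ, ∑ b ∈ range (B + 1), F (j + 1) b ≤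
        2 * ((((j : ℝ) + 1) ^ 2)⁻¹) + 2 * Real.pi * (((j : ℝ) + 1)⁻¹) := by
      intro j
      have h := row_sum_inv_normSq_le (j + 1) (B + 1) (by omega)
      have ht : ∀ b : ℕ, F (j + 1) b =
          2 * ((if b = 0 then (1:ℝ) else 2) * ((((j + 1 : ℕ) : ℝ)) ^ 2 + (b : ℝ) ^ 2)⁻¹) := by
        intro b
        simp only [hF, Nat.succ_ne_zero, false_and, if_false]
        ring
      rw [sum_congr rfl fun b _ => ht b, ← mul_sum]
      push_cast at h ⊢
      rw [div_eq_mul_inv] at h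
      linarith
    calc ∑ j ∈ range B, ∑ b ∈ range (B + 1), F (j + 1) b + ∑ b ∈ range (B + 1), F 0 b
        ≤ ∑ j ∈ range B, (2 * ((((j : ℝ) + 1) ^ 2)⁻¹) + 2 * Real.pi * (((j : ℝ) + 1)⁻¹)) + 4 :=
          add_le_add (sum_le_sum fun j _ => hrows j) hrow0
      _ = 2 * ∑ j ∈ range B, ((((j : ℝ) + 1) ^ 2)⁻¹) +
            2 * Real.pi * ∑ j ∈ range B, (((j : ℝ) + 1)⁻¹) + 4 := by
          rw [sum_add_distrib, mul_sum, mul_sum]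
      _ ≤ 2 * 2 + 2 * Real.pi * (harmonic (B + 1) : ℝ) + 4 := by
          have h1 := sum_inv_succ_sq_le_two B
          have h2 : ∑ j ∈ range B, (((j : ℝ) + 1)⁻¹) ≤ (harmonic (B + 1) : ℝ) := by
            rw [sum_range_inv_succ_eq_harmonic, harmonic_succ]
            push_cast
            have : (0:ℝ) ≤ ((B : ℝ) + 1)⁻¹ := by positivity
            linarith
          nlinarith [Real.pi_pos]
      _ = 2 * Real.pi * (harmonic (B + 1) : ℝ) + 8 := by ring

/-- **The lattice corrections in Koma–Tasaki's P2 are bounded**: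
`Σ_{(a,b) ∈ [0,ρ)², (a,b) ≠ (0,0)} μ_a μ_b (a + b + 1)/(a² + b²)² ≤ 68`, uniformly in `ρ` (the
non-logarithmic part of `Σ_{bonds}(cosh ∇φ - 1)` for `φ = q log|u|₂`). Koma–Tasaki, PRL 68 (1992)
3248, proof of eq. (13), property P2. [cite: KomaTasakiPRL1992, proof of eq. (13) (P2)] -/
theorem sum_sum_secondary_le (ρ : ℕ) :
    ∑ a ∈ range ρ, ∑ b ∈ range ρ,
      (if a = 0 ∧ b = 0 then (0:ℝ) else
        (if a = 0 then (1:ℝ) else 2) * (if b = 0 then (1:ℝ) else 2) *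
          (((a : ℝ) + b + 1) * ((((a : ℝ) ^ 2 + (b : ℝ) ^ 2) ^ 2)⁻¹))) ≤ 68 := by
  set F : ℕ → ℕ → ℝ := fun a b =>
    if a = 0 ∧ b = 0 then (0:ℝ) else
      (if a = 0 then (1:ℝ) else 2) * (if b = 0 then (1:ℝ) else 2) *
        (((a : ℝ) + b + 1) * ((((a : ℝ) ^ 2 + (b : ℝ) ^ 2) ^ 2)⁻¹)) with hF
  rcases Nat.eq_zero_or_pos ρ with rfl | hρ
  · simp
  · obtain ⟨B, rfl⟩ : ∃ B, ρ = B + 1 := ⟨ρ - 1, by omega⟩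
    rw [sum_range_succ']
    -- the row `a = 0`: `2(b+1)/b⁴ ≤ 4/b²` for `b ≥ 1`
    have hrow0 : ∑ b ∈ range (B + 1), F 0 b ≤ 8 := by
      rw [sum_range_succ']
      have ht : ∀ j : ℕ, F 0 (j + 1) ≤ 4 * ((((j : ℝ) + 1) ^ 2)⁻¹) := by
        intro j
        simp only [hF, Nat.succ_ne_zero, and_false, if_false, if_true]
        push_cast
        have hj : (0:ℝ) ≤ j := Nat.cast_nonneg j
        have hj1 : (0:ℝ) < (j : ℝ) + 1 := by positivity
        rw [show (1:ℝ) * 2 * ((0 + ((j : ℝ) + 1) + 1) * (((0 : ℝ) ^ 2 + ((j : ℝ) + 1) ^ 2) ^ 2)⁻¹)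
            = (2 * ((j : ℝ) + 1) + 2) / (((j : ℝ) + 1) ^ 2) ^ 2 by ring,
          show (4 : ℝ) * ((((j : ℝ) + 1) ^ 2)⁻¹) = 4 / ((j : ℝ) + 1) ^ 2 by ring,
          div_le_div_iff₀ (by positivity) (by positivity)]
        nlinarith [pow_pos hj1 2, pow_pos hj1 3, mul_nonneg hj (pow_pos hj1 2).le]
      have hz : F 0 0 = 0 := by simp [hF]
      rw [hz, add_zero]
      calc ∑ j ∈ range B, F 0 (j + 1) ≤ ∑ j ∈ range B, 4 * ((((j : ℝ) + 1) ^ 2)⁻¹) :=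
            sum_le_sum fun j _ => ht j
        _ = 4 * ∑ j ∈ range B, ((((j : ℝ) + 1) ^ 2)⁻¹) := by rw [mul_sum]
        _ ≤ 8 := by linarith [sum_inv_succ_sq_le_two B]
    -- the rows `a = j + 1`
    have hrows : ∀ j : ℕ, ∑ b ∈ range (B + 1), F (j + 1) b ≤ 30 * ((((j : ℝ) + 1) ^ 2)⁻¹) := by
      intro j
      have h := row_sum_secondary_le (j + 1) (B + 1) (by omega)
      have ht : ∀ b : ℕ, F (j + 1) b =
          2 * ((if b = 0 then (1:ℝ) else 2) *
            ((((j + 1 : ℕ) : ℝ) + b + 1) *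
              (((((j + 1 : ℕ) : ℝ)) ^ 2 + (b : ℝ) ^ 2) ^ 2)⁻¹)) := by
        intro b
        simp only [hF, Nat.succ_ne_zero, false_and, if_false]
        ring
      rw [sum_congr rfl fun b _ => ht b, ← mul_sum]
      push_cast at h ⊢
      have hj1 : (0:ℝ) < (j : ℝ) + 1 := by positivity
      have hj1' : (1:ℝ) ≤ (j : ℝ) + 1 := by linarith [(Nat.cast_nonneg j : (0:ℝ) ≤ j)]
      -- 2 · 3 (1/a² + π/a)/a ≤ 30/a² using π < 4 and a ≥ 1
      have hpi := Real.pi_le_four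
      have hinv : ((j : ℝ) + 1)⁻¹ ≤ 1 := inv_le_one_of_one_le₀ hj1'
      have hA : (((j : ℝ) + 1) ^ 2)⁻¹ = ((j : ℝ) + 1)⁻¹ * ((j : ℝ) + 1)⁻¹ := by
        rw [sq, mul_inv]
      have hC : 3 * ((((j : ℝ) + 1) ^ 2)⁻¹ + Real.pi / ((j : ℝ) + 1)) / ((j : ℝ) + 1) =
          3 * (((j : ℝ) + 1)⁻¹ * ((j : ℝ) + 1)⁻¹) * (((j : ℝ) + 1)⁻¹ + Real.pi) := by
        field_simp
      rw [hC] at h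
      rw [hA]
      have hι : 0 < ((j : ℝ) + 1)⁻¹ := by positivity
      nlinarith [mul_pos hι hι, mul_le_mul_of_nonneg_left hinv (mul_pos hι hι).le]
    calc ∑ j ∈ range B, ∑ b ∈ range (B + 1), F (j + 1) b + ∑ b ∈ range (B + 1), F 0 b
        ≤ ∑ j ∈ range B, 30 * ((((j : ℝ) + 1) ^ 2)⁻¹) + 8 :=
          add_le_add (sum_le_sum fun j _ => hrows j) hrow0
      _ = 30 * ∑ j ∈ range B, ((((j : ℝ) + 1) ^ 2)⁻¹) + 8 := by rw [mul_sum]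
      _ ≤ 30 * 2 + 8 := by nlinarith [sum_inv_succ_sq_le_two B]
      _ = 68 := by norm_num

/-! ### The per-site majorant -/

/-- `cosh x - 1 ≤ x²/2 + (x²/2)² e^{x²/2}` (from `cosh x ≤ e^{x²/2}` and `e^y - 1 ≤ y e^y`,
applied twice: the quartic remainder is ADDITIVE). [folklore] -/
private theorem cosh_sub_one_le_sq_add_quartic (x : ℝ) :
    Real.cosh x - 1 ≤ x ^ 2 / 2 + (x ^ 2 / 2) ^ 2 * Real.exp (x ^ 2 / 2) := by
  set y : ℝ := x ^ 2 / 2 with hy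
  have hy0 : 0 ≤ y := by positivity
  have h1 : Real.cosh x ≤ Real.exp y := Real.cosh_le_exp_half_sq x
  have h2 : 1 - y ≤ Real.exp (-y) := by
    have := Real.add_one_le_exp (-y); linarith
  have h3 : Real.exp y * (1 - y) ≤ 1 := by
    have := mul_le_mul_of_nonneg_left h2 (Real.exp_pos y).le
    rwa [← Real.exp_add, add_neg_cancel, Real.exp_zero] at this
  -- `e^y - 1 ≤ y e^y` and `y e^y ≤ y (1 + y e^y)`
  have h4 : Real.exp y - 1 ≤ y * Real.exp y := by nlinarith
  have h5 : y * Real.exp y ≤ y * (1 + y * Real.exp y) :=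
    mul_le_mul_of_nonneg_left (by linarith) hy0
  nlinarith

/-- One lattice direction: for `q ≥ 0`, `n ≥ 1`, `a² ≤ n` (`a ∈ ℕ`),
`cosh(q(2a+1)/(2n)) - 1 ≤ q²(2a+1)²/(8n²) + (81/64) q⁴ e^{2q²}/n²`. [folklore] -/
private theorem cosh_step_sub_one_le (q : ℝ) (a : ℕ) (n : ℝ) (hn : 1 ≤ n)
    (han : (a : ℝ) ^ 2 ≤ n) :
    Real.cosh (q * (2 * a + 1) / (2 * n)) - 1 ≤
      q ^ 2 * (2 * (a : ℝ) + 1) ^ 2 / (8 * n ^ 2) +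
        81 / 64 * q ^ 4 * Real.exp (2 * q ^ 2) / n ^ 2 := by
  have hn0 : 0 < n := by linarith
  have ha0 : (0 : ℝ) ≤ a := Nat.cast_nonneg a
  have haa : (a : ℝ) ≤ (a : ℝ) ^ 2 := by exact_mod_cast Nat.le_self_pow two_ne_zero a
  set x : ℝ := q * (2 * a + 1) / (2 * n) with hx
  have hx2 : x ^ 2 = q ^ 2 * (2 * (a : ℝ) + 1) ^ 2 / (4 * n ^ 2) := by
    rw [hx, div_pow, mul_pow]
    ring
  have h9 : (2 * (a : ℝ) + 1) ^ 2 ≤ 9 * n := by nlinarith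
  have hx2le : x ^ 2 ≤ 9 * q ^ 2 / (4 * n) := by
    rw [hx2]
    calc q ^ 2 * (2 * (a : ℝ) + 1) ^ 2 / (4 * n ^ 2) ≤ q ^ 2 * (9 * n) / (4 * n ^ 2) := by
          gcongr
      _ = 9 * q ^ 2 / (4 * n) := by field_simp
  have hx2le' : x ^ 2 ≤ 4 * q ^ 2 := by
    refine hx2le.trans ?_
    rw [div_le_iff₀ (by positivity)]
    nlinarith [sq_nonneg q]
  have hexp : Real.exp (x ^ 2 / 2) ≤ Real.exp (2 * q ^ 2) := Real.exp_le_exp.2 (by linarith)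
  have hquart : (x ^ 2 / 2) ^ 2 * Real.exp (x ^ 2 / 2) ≤
      (9 * q ^ 2 / (4 * n) / 2) ^ 2 * Real.exp (2 * q ^ 2) := by
    gcongr
  calc Real.cosh x - 1 ≤ x ^ 2 / 2 + (x ^ 2 / 2) ^ 2 * Real.exp (x ^ 2 / 2) :=
        cosh_sub_one_le_sq_add_quartic x
    _ ≤ x ^ 2 / 2 + (9 * q ^ 2 / (4 * n) / 2) ^ 2 * Real.exp (2 * q ^ 2) := by linarith
    _ = q ^ 2 * (2 * (a : ℝ) + 1) ^ 2 / (8 * n ^ 2) +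
          81 / 64 * q ^ 4 * Real.exp (2 * q ^ 2) / n ^ 2 := by
        rw [hx2]
        field_simp
        ring

/-- **Per-site majorant of the Euclidean logarithmic potential.** For `q ≥ 0` and cyclic
coordinates `(a, b) ≠ (0, 0)`, `n = a² + b²`, the outward bond weights at the site satisfy
`μ'_a (cosh(q(2a+1)/(2n)) - 1) + μ'_b (cosh(q(2b+1)/(2n)) - 1)
  ≤ q²/(2n) + (q²/2 + 4 q⁴ e^{2q²}) (a + b + 1)/n²`
(`μ'_0 = 2`: both neighbours along a zero coordinate are outward; `μ'_k = 1` for `k ≥ 1`).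
The leading term `q²/(2n)` is what sums to `π q² log ρ`: this is the site-wise form of
Koma–Tasaki's P2 `Σ_{bonds}(cosh ∇φ - 1) ≈ (q²/2) Σ|∇φ|²` for `φ = q log|u|₂`, PRL 68 (1992) 3248,
proof of eq. (13). [cite: KomaTasakiPRL1992, proof of eq. (13) (P2)] -/
theorem two_dir_cosh_sub_one_le (q : ℝ) (a b : ℕ) (hab : ¬ (a = 0 ∧ b = 0)) :
    (if a = 0 then (2:ℝ) else 1) *
        (Real.cosh (q * (2 * a + 1) / (2 * ((a : ℝ) ^ 2 + (b : ℝ) ^ 2))) - 1) +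
      (if b = 0 then (2:ℝ) else 1) *
        (Real.cosh (q * (2 * b + 1) / (2 * ((a : ℝ) ^ 2 + (b : ℝ) ^ 2))) - 1) ≤
      q ^ 2 / (2 * ((a : ℝ) ^ 2 + (b : ℝ) ^ 2)) +
        (q ^ 2 / 2 + 4 * q ^ 4 * Real.exp (2 * q ^ 2)) *
          (((a : ℝ) + b + 1) * ((((a : ℝ) ^ 2 + (b : ℝ) ^ 2) ^ 2)⁻¹)) := by
  set n : ℝ := (a : ℝ) ^ 2 + (b : ℝ) ^ 2 with hndef
  have ha0 : (0 : ℝ) ≤ a := Nat.cast_nonneg a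
  have hb0 : (0 : ℝ) ≤ b := Nat.cast_nonneg b
  have hn1 : 1 ≤ n := by
    rcases Nat.eq_zero_or_pos a with rfl | ha
    · have hb : 1 ≤ b := Nat.one_le_iff_ne_zero.2 (fun h => hab ⟨rfl, h⟩)
      have hb1 : (1:ℝ) ≤ b := by exact_mod_cast hb
      rw [hndef]; push_cast; nlinarith
    · have ha1 : (1:ℝ) ≤ a := by exact_mod_cast ha
      rw [hndef]; nlinarith
  have hn0 : 0 < n := by linarith
  have hA := cosh_step_sub_one_le q a n hn1 (by rw [hndef]; nlinarith)
  have hB := cosh_step_sub_one_le q b n hn1 (by rw [hndef]; nlinarith)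
  have hEa : 0 ≤ Real.cosh (q * (2 * a + 1) / (2 * n)) - 1 := sub_nonneg.2 (Real.one_le_cosh _)
  have hEb : 0 ≤ Real.cosh (q * (2 * b + 1) / (2 * n)) - 1 := sub_nonneg.2 (Real.one_le_cosh _)
  set E : ℝ := 81 / 64 * q ^ 4 * Real.exp (2 * q ^ 2) with hE
  have hE0 : 0 ≤ E := by positivity
  have hq2 : 0 ≤ q ^ 2 := sq_nonneg q
  have hq4 : 0 ≤ q ^ 4 * Real.exp (2 * q ^ 2) := by positivity
  -- rewrite the target over the common denominator `n²`
  have hgoal : q ^ 2 / (2 * n) + (q ^ 2 / 2 + 4 * q ^ 4 * Real.exp (2 * q ^ 2)) *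
      (((a : ℝ) + b + 1) * ((n ^ 2)⁻¹)) =
      (q ^ 2 * n / 2 + (q ^ 2 / 2 + 4 * q ^ 4 * Real.exp (2 * q ^ 2)) * ((a : ℝ) + b + 1)) /
        n ^ 2 := by
    field_simp
  have hAB : q ^ 2 * (2 * (a : ℝ) + 1) ^ 2 / (8 * n ^ 2) + E / n ^ 2 =
      (q ^ 2 * (2 * (a : ℝ) + 1) ^ 2 / 8 + E) / n ^ 2 := by
    field_simp
  have hBB : q ^ 2 * (2 * (b : ℝ) + 1) ^ 2 / (8 * n ^ 2) + E / n ^ 2 =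
      (q ^ 2 * (2 * (b : ℝ) + 1) ^ 2 / 8 + E) / n ^ 2 := by
    field_simp
  have hA' : Real.cosh (q * (2 * a + 1) / (2 * n)) - 1 ≤
      (q ^ 2 * (2 * (a : ℝ) + 1) ^ 2 / 8 + E) / n ^ 2 := by
    rw [← hAB]; simpa [hE, mul_div_assoc] using hA
  have hB' : Real.cosh (q * (2 * b + 1) / (2 * n)) - 1 ≤
      (q ^ 2 * (2 * (b : ℝ) + 1) ^ 2 / 8 + E) / n ^ 2 := by
    rw [← hBB]; simpa [hE, mul_div_assoc] using hB
  rw [hgoal]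
  have hn2 : 0 < n ^ 2 := by positivity
  -- case analysis on the zero coordinates
  rcases Nat.eq_zero_or_pos a with rfl | ha
  · have hb : b ≠ 0 := fun h => hab ⟨rfl, h⟩
    rw [if_pos rfl, if_neg hb]
    have hnb : n = (b : ℝ) ^ 2 := by rw [hndef]; push_cast; ring
    calc 2 * (Real.cosh (q * (2 * ((0:ℕ) : ℝ) + 1) / (2 * n)) - 1) +
          1 * (Real.cosh (q * (2 * b + 1) / (2 * n)) - 1)
        ≤ 2 * ((q ^ 2 * (2 * ((0:ℕ) : ℝ) + 1) ^ 2 / 8 + E) / n ^ 2) +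
          1 * ((q ^ 2 * (2 * (b : ℝ) + 1) ^ 2 / 8 + E) / n ^ 2) := by
            gcongr
      _ = (2 * (q ^ 2 * (2 * ((0:ℕ) : ℝ) + 1) ^ 2 / 8 + E) +
            (q ^ 2 * (2 * (b : ℝ) + 1) ^ 2 / 8 + E)) / n ^ 2 := by ring
      _ ≤ _ := by
          refine div_le_div_of_nonneg_right ?_ hn2.le
          push_cast
          rw [hnb, hE]
          nlinarith [mul_nonneg hq2 hb0, mul_nonneg hq4 hb0]
  · rcases Nat.eq_zero_or_pos b with rfl | hb
    · have ha' : a ≠ 0 := by omega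
      rw [if_neg ha', if_pos rfl]
      have hna : n = (a : ℝ) ^ 2 := by rw [hndef]; push_cast; ring
      calc 1 * (Real.cosh (q * (2 * a + 1) / (2 * n)) - 1) +
            2 * (Real.cosh (q * (2 * ((0:ℕ) : ℝ) + 1) / (2 * n)) - 1)
          ≤ 1 * ((q ^ 2 * (2 * (a : ℝ) + 1) ^ 2 / 8 + E) / n ^ 2) +
            2 * ((q ^ 2 * (2 * ((0:ℕ) : ℝ) + 1) ^ 2 / 8 + E) / n ^ 2) := by
              gcongr
        _ = ((q ^ 2 * (2 * (a : ℝ) + 1) ^ 2 / 8 + E) +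
              2 * (q ^ 2 * (2 * ((0:ℕ) : ℝ) + 1) ^ 2 / 8 + E)) / n ^ 2 := by ring
        _ ≤ _ := by
            refine div_le_div_of_nonneg_right ?_ hn2.le
            push_cast
            rw [hna, hE]
            nlinarith [mul_nonneg hq2 ha0, mul_nonneg hq4 ha0]
    · have ha' : a ≠ 0 := by omega
      have hb' : b ≠ 0 := by omega
      rw [if_neg ha', if_neg hb']
      calc 1 * (Real.cosh (q * (2 * a + 1) / (2 * n)) - 1) +
            1 * (Real.cosh (q * (2 * b + 1) / (2 * n)) - 1)
          ≤ 1 * ((q ^ 2 * (2 * (a : ℝ) + 1) ^ 2 / 8 + E) / n ^ 2) +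
            1 * ((q ^ 2 * (2 * (b : ℝ) + 1) ^ 2 / 8 + E) / n ^ 2) := by
              gcongr
        _ = ((q ^ 2 * (2 * (a : ℝ) + 1) ^ 2 / 8 + E) +
              (q ^ 2 * (2 * (b : ℝ) + 1) ^ 2 / 8 + E)) / n ^ 2 := by ring
        _ ≤ _ := by
            refine div_le_div_of_nonneg_right ?_ hn2.le
            rw [hndef, hE]
            nlinarith [mul_nonneg hq2 ha0, mul_nonneg hq2 hb0, mul_nonneg hq4 ha0,
              mul_nonneg hq4 hb0]

end Literature.MathematicalPhysics.QuantumLattice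

end
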